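import Literature.NumberTheory.Automorphic.UnitaryGroupFinAdelicCenter
import Literature.NumberTheory.Automorphic.UnitaryGroupDualPairReindex
import HarnessLib

/-!
# The centre `E¹(𝔸_{F,f}) → U(J)(𝔸_{F,f})` place by place: local centres `U(1)(F_v) → U(J)(F_v)`

Topic `NumberTheory/Automorphic`; namespace `Literature.NumberTheory.Automorphic.UnitaryGroup`.  KERNEL ONLY:
definitions with bodies and theorems; no record, no named fact, no `sorry`.

[Mok2014, §1 Notation p. 5] identifies the centre of `U_{E/F}(N)` with `U_{E/F}(1) = E¹`; [Liu2021, App. D §D.1 Step 3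
(`FJcycle.tex` l. 5221)] takes, at every finite place `v`, «the maximal quotient … on which the centre `E_v¹` of `U(V)(F_v)`
acts by `χ_v`», and [Liu2021, Def. 4.11 (l. 2092–2096)] glues `⊗'_v` over the places.  The tree has the finite-adelic
centre `UnitaryGroup.finAdelicCenter : E¹(𝔸_{F,f}) →* U(J)(𝔸_{F,f})` (`u ↦ u·1_N`) and the factorisation
`finAdelicEquiv : U(J)(𝔸_{F,f}) ≃ₜ* Πʳ_v [U(J)(F_v), U(J)(𝒪_v)]` (`UnitaryGroupRestrictedProduct`); this file supplies
the PLACE-BY-PLACE form of the centre needed to read «the centre acts by `χ = ∏ χ_v`» factor by factor: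

* §1 `localCenter … hJ₁ v : U(J₁)(F_v) →* U(J)(F_v)` for a hermitian LINE `J₁ = (j)`, `j ≠ 0` (so `U(J₁) = U(1) = E¹`):
  on the factor form `localPi … v ≤ Π_{w ∣ v} GL(E_w)` it is `(g_w)_w ↦ ((g_w)₀₀ · 1_N)_w` (`coe_localScalarGL_apply`);
  it is CENTRAL (`localCenter_comm`) and maps `U(J₁)(𝒪_v)` into `U(J)(𝒪_v)` (`localCenter_mapsTo_localInt`);
* §2 `finAdelicEquiv_finAdelicCenter` — **compatibility with the global centre**: the `v`-component of `u·1_N` is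
  `localCenter v` of the `v`-component of `u·1_1`; in `Πʳ_v`: `finAdelicEquiv (u·1_N) = Πʳ(localCenter) (finAdelicEquiv (u·1_1))`
  (`finAdelicEquiv_finAdelicCenter_eq_mapAlong`); and for a line `W`, `finPairEmb (1, u·1_W) = u·1_n`
  (`finPairEmb_one_finAdelicCenter`: the `U(J_W)`-member of the dual pair IS the centre of the big group);
* §3 the rank-one dictionary `E¹(𝔸_{F,f}) ≅ U(J₁)(𝔸_{F,f})`: the inverse `finAdelicCenterInv : U(J₁)(𝔸_{F,f}) →* E¹(𝔸_{F,f})`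
  (`g ↦ det g = g₀₀`) of `finAdelicCenter … 1 J₁`, both CONTINUOUS, and the transport of a character `χ₁` of `E¹(𝔸_{F,f})`
  to `Πʳ_v [U(J₁)(F_v), U(J₁)(𝒪_v)]` (`charOfCenter`, `charOfCenter_comp`, `continuous_charOfCenter`).

Written for the Hodge/COR-CM transposition lane (item (vi)): with these, the coinvariants of the finite Weil
representation under the centre at a continuous `χ₁` become `⊗'_v` of the local central quotients
(`GroupTheory/RestrictedProductCharacterFactors`, `GelbartRogawski1991/FiniteAdelicWeilCentralCoinvariants`).

## References
* [Mok2014] C. P. Mok, Mem. AMS 235 (2015), §1 Notation p. 5.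
* [Liu2021] Y. Liu, Camb. J. Math. 9 (2021) = arXiv:2102.11518, Def. 4.11 (l. 2092–2096), App. D §D.1 Step 3 (l. 5221).
* [PlatonovRapinchuk1994] V. Platonov, A. Rapinchuk, *Algebraic Groups and Number Theory* (1994), §5.1.
-/

set_option autoImplicit false

noncomputable section

open scoped Matrix Kronecker RestrictedProduct
open NumberField IsDedekindDomain Filter Set

namespace Literature.NumberTheory.Automorphic.UnitaryGroup

variable (F E : Type) [Field F] [NumberField F] [Field E] [NumberField E] [Algebra F E]
variable (c : E ≃ₐ[F] E) (N : ℕ) (J : Matrix (Fin N) (Fin N) E) (J₁ : Matrix (Fin 1) (Fin 1) E)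

/-! ## §1 The local centre `U(J₁)(F_v) → U(J)(F_v)` for a line `J₁` -/

section Local

variable {F}

omit [NumberField E] in
/-- `(d • 1).map f = f d • 1` for a ring homomorphism `f`. [cite: Mok2014, §1 Notation p. 5] -/
theorem map_smul_one {R S : Type*} [CommRing R] [CommRing S] (f : R →+* S) (d : R) :
    ((d • (1 : Matrix (Fin N) (Fin N) R)).map f) = f d • (1 : Matrix (Fin N) (Fin N) S) := by
  ext i j
  simp only [Matrix.map_apply, Matrix.smul_apply, Matrix.one_apply, smul_eq_mul, mul_ite, mul_one, mul_zero]
  split_ifs <;> simp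

/-- `(g_w)_w ↦ (det g_w · 1_N)_w` on `Π_{w ∣ v} GL_1(E_w) → Π_{w ∣ v} GL_N(E_w)`. [cite: Mok2014, §1 Notation p. 5] -/
def localScalarGL (v : HeightOneSpectrum (𝓞 F)) : LocalGLPi E 1 v →* LocalGLPi E N v where
  toFun g w := Units.map (Matrix.scalar (Fin N) : w.1.adicCompletion E →+* Matrix (Fin N) (Fin N) (w.1.adicCompletion E)).toMonoidHom
    (Matrix.GeneralLinearGroup.det (g w))
  map_one' := funext fun w => by rw [Pi.one_apply, map_one, map_one]; rfl
  map_mul' g h := funext fun w => by rw [Pi.mul_apply, map_mul, map_mul]; rfl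

omit [NumberField F] in
/-- matrix of the `w`-component: `(g_w)₀₀ · 1_N`. [cite: Mok2014, §1 Notation p. 5] -/
theorem coe_localScalarGL_apply (v : HeightOneSpectrum (𝓞 F)) (g : LocalGLPi E 1 v) (w : PlacesOver E v) :
    ((localScalarGL E N v g w : GL (Fin N) (w.1.adicCompletion E)) : Matrix (Fin N) (Fin N) (w.1.adicCompletion E)) =
      ((g w : GL (Fin 1) (w.1.adicCompletion E)) : Matrix (Fin 1) (Fin 1) (w.1.adicCompletion E)) 0 0 •
        (1 : Matrix (Fin N) (Fin N) (w.1.adicCompletion E)) := by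
  change Matrix.scalar (Fin N) ((Matrix.GeneralLinearGroup.det (g w) : (w.1.adicCompletion E)ˣ) : w.1.adicCompletion E) = _
  rw [Matrix.GeneralLinearGroup.val_det_apply, Matrix.det_fin_one, Matrix.scalar_apply, Matrix.smul_one_eq_diagonal]

omit [NumberField F] in
/-- matrix of the inverse of the `w`-component: `(g_w⁻¹)₀₀ · 1_N`. [cite: Mok2014, §1 Notation p. 5] -/
theorem coe_localScalarGL_apply_inv (v : HeightOneSpectrum (𝓞 F)) (g : LocalGLPi E 1 v) (w : PlacesOver E v) :
    (((localScalarGL E N v g w)⁻¹ : GL (Fin N) (w.1.adicCompletion E)) : Matrix (Fin N) (Fin N) (w.1.adicCompletion E)) =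
      (((g w)⁻¹ : GL (Fin 1) (w.1.adicCompletion E)) : Matrix (Fin 1) (Fin 1) (w.1.adicCompletion E)) 0 0 •
        (1 : Matrix (Fin N) (Fin N) (w.1.adicCompletion E)) := by
  rw [← Pi.inv_apply, ← map_inv]
  exact coe_localScalarGL_apply E N v g⁻¹ w

/-- **the scalar norm-one relation at `w`** extracted from membership in `U(J₁)(F_v)`, `J₁ = (j)`, `j ≠ 0`:
`c_*((g_{c⁻¹w})₀₀) · (g_w)₀₀ = 1`. [cite: Mok2014, §1 Notation p. 5] -/
theorem galMap_entry_mul_entry_eq_one (hJ₁ : J₁ 0 0 ≠ 0) (v : HeightOneSpectrum (𝓞 F)) (g : localPi E c 1 J₁ v)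
    (w : PlacesOver E v) :
    galAdicCompletionMap c (smul_inv_smul c w.1)
        ((((g : LocalGLPi E 1 v) (PlacesOver.galInv c w) : GL (Fin 1) ((PlacesOver.galInv c w).1.adicCompletion E)) :
          Matrix (Fin 1) (Fin 1) ((PlacesOver.galInv c w).1.adicCompletion E)) 0 0) *
      (((g : LocalGLPi E 1 v) w : GL (Fin 1) (w.1.adicCompletion E)) : Matrix (Fin 1) (Fin 1) (w.1.adicCompletion E)) 0 0 = 1 := by
  have hg := (mem_localPi_iff E c 1 J₁ v (g : LocalGLPi E 1 v)).1 g.2 w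
  have h00 := congrFun (congrFun hg 0) 0
  simp only [Matrix.mul_apply, Fin.sum_univ_one, Matrix.transpose_apply, Matrix.map_apply] at h00
  -- `J₁ 0 0 ≠ 0` in `E_w`
  have hj : algebraMap E (w.1.adicCompletion E) (J₁ 0 0) ≠ 0 := (map_ne_zero _).2 hJ₁
  refine mul_right_cancel₀ hj ?_
  rw [one_mul, mul_right_comm]
  exact h00

/-- `localScalarGL` maps `U(J₁)(F_v)` into `U(J)(F_v)`: `(c_*(d') · 1)ᵀ J (d · 1) = (c_*(d') d) · J = J`.
[cite: Mok2014, §1 Notation p. 5] -/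
theorem localScalarGL_mem (hJ₁ : J₁ 0 0 ≠ 0) (v : HeightOneSpectrum (𝓞 F)) (g : localPi E c 1 J₁ v) :
    localScalarGL E N v (g : LocalGLPi E 1 v) ∈ localPi E c N J v := by
  rw [mem_localPi_iff]
  intro w
  rw [coe_localScalarGL_apply, coe_localScalarGL_apply, map_smul_one, Matrix.transpose_smul, Matrix.transpose_one,
    Matrix.smul_mul, Matrix.one_mul, Matrix.mul_smul, Matrix.mul_one, smul_smul, mul_comm,
    galMap_entry_mul_entry_eq_one E c J₁ hJ₁ v g w, one_smul]

/-- **the local centre `U(J₁)(F_v) →* U(J)(F_v)`**, `(g_w)_w ↦ ((g_w)₀₀ · 1_N)_w` — [Liu2021, App. D §D.1 Step 3]'s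
centre `E_v¹` of `U(V)(F_v)`, with `E_v¹` presented as `U(J₁)(F_v)` for the line `J₁`. [cite: Mok2014, §1 Notation p. 5] -/
def localCenter (hJ₁ : J₁ 0 0 ≠ 0) (v : HeightOneSpectrum (𝓞 F)) : localPi E c 1 J₁ v →* localPi E c N J v :=
  ((localScalarGL E N v).comp (localPi E c 1 J₁ v).subtype).codRestrict _ fun g => localScalarGL_mem E c N J J₁ hJ₁ v g

/-- underlying family of `localCenter v g`. [cite: Mok2014, §1 Notation p. 5] -/
@[simp] theorem coe_localCenter (hJ₁ : J₁ 0 0 ≠ 0) (v : HeightOneSpectrum (𝓞 F)) (g : localPi E c 1 J₁ v) :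
    ((localCenter E c N J J₁ hJ₁ v g : localPi E c N J v) : LocalGLPi E N v) = localScalarGL E N v (g : LocalGLPi E 1 v) :=
  rfl

/-- **the local centre is central**: scalar matrices commute with everything. [cite: Mok2014, §1 Notation p. 5] -/
theorem localCenter_comm (hJ₁ : J₁ 0 0 ≠ 0) (v : HeightOneSpectrum (𝓞 F)) (g : localPi E c 1 J₁ v)
    (k : localPi E c N J v) :
    k * localCenter E c N J J₁ hJ₁ v g = localCenter E c N J J₁ hJ₁ v g * k := by
  refine Subtype.ext (funext fun w => ?_)
  change (k : LocalGLPi E N v) w * localScalarGL E N v (g : LocalGLPi E 1 v) w =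
    localScalarGL E N v (g : LocalGLPi E 1 v) w * (k : LocalGLPi E N v) w
  refine Units.ext ?_
  rw [Units.val_mul, Units.val_mul, coe_localScalarGL_apply, Matrix.mul_smul, Matrix.mul_one, Matrix.smul_mul,
    Matrix.one_mul]

/-- **`localCenter` maps `U(J₁)(𝒪_v)` into `U(J)(𝒪_v)`** (an integral unit `d` gives integral `d · 1_N` and
`d⁻¹ · 1_N`). [cite: PlatonovRapinchuk1994, §5.1] -/
theorem localCenter_mapsTo_localInt (hJ₁ : J₁ 0 0 ≠ 0) (v : HeightOneSpectrum (𝓞 F)) :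
    MapsTo (localCenter E c N J J₁ hJ₁ v) ((localInt E c 1 J₁ v : Subgroup (localPi E c 1 J₁ v)) : Set (localPi E c 1 J₁ v))
      ((localInt E c N J v : Subgroup (localPi E c N J v)) : Set (localPi E c N J v)) := by
  intro g hg
  rw [SetLike.mem_coe, mem_localInt_iff] at hg ⊢
  intro w
  obtain ⟨h1, h2⟩ := (mem_glInt_iff _).1 (hg w)
  rw [coe_localCenter, mem_glInt_iff]
  refine ⟨fun i j => ?_, fun i j => ?_⟩
  · rw [coe_localScalarGL_apply, Matrix.smul_apply, smul_eq_mul, Matrix.one_apply]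
    split_ifs
    · rw [mul_one]; exact h1 0 0
    · rw [mul_zero]; exact zero_mem _
  · rw [coe_localScalarGL_apply_inv, Matrix.smul_apply, smul_eq_mul, Matrix.one_apply]
    split_ifs
    · rw [mul_one]; exact h2 0 0
    · rw [mul_zero]; exact zero_mem _

end Local

/-! ## §2 Compatibility with the global centre `u ↦ u·1_N` -/

section Global

omit [NumberField F] in
/-- the `w`-component of `u·1_N` is the scalar matrix `u_w · 1_N`. [cite: Mok2014, §1 Notation p. 5] -/
theorem coe_evalAt_finAdelicCenter (u : finAdelicOne F E c) (w : HeightOneSpectrum (𝓞 E)) :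
    ((GLn.evalAt N E w ((finAdelicCenter F E c N J u : finAdelic F E c N J) : GL (Fin N) (FiniteAdeleRing (𝓞 E) E)) :
        GL (Fin N) (w.adicCompletion E)) : Matrix (Fin N) (Fin N) (w.adicCompletion E)) =
      AdelicGroupData.finiteAdeleEval E w (((u : (FiniteAdeleRing (𝓞 E) E)ˣ) : FiniteAdeleRing (𝓞 E) E)) •
        (1 : Matrix (Fin N) (Fin N) (w.adicCompletion E)) := by
  rw [← map_eval_eq_evalAt, coe_finAdelicCenter, map_smul_one]

/-- **the `v`-component of `u·1_N` is `localCenter v` of the `v`-component of `u·1_1`.** [cite: Mok2014, §1 Notation p. 5] -/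
theorem finAdelicEquiv_finAdelicCenter (hJ₁ : J₁ 0 0 ≠ 0) (u : finAdelicOne F E c) (v : HeightOneSpectrum (𝓞 F)) :
    finAdelicEquiv F E c N J (finAdelicCenter F E c N J u) v =
      localCenter E c N J J₁ hJ₁ v (finAdelicEquiv F E c 1 J₁ (finAdelicCenter F E c 1 J₁ u) v) := by
  refine Subtype.ext (funext fun w => Units.ext ?_)
  rw [finAdelicEquiv_apply_coe, coe_evalAt_finAdelicCenter, coe_localCenter, coe_localScalarGL_apply,
    finAdelicEquiv_apply_coe, coe_evalAt_finAdelicCenter, Matrix.smul_apply, Matrix.one_apply_eq, smul_eq_mul, mul_one]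

/-- the same in `Πʳ_v`: `finAdelicEquiv (u·1_N) = Πʳ(localCenter) (finAdelicEquiv (u·1_1))` (Mathlib's `mapAlongMonoidHom`
along `id` with the integrality clause `localCenter_mapsTo_localInt`). [cite: Mok2014, §1 Notation p. 5] -/
theorem finAdelicEquiv_finAdelicCenter_eq_mapAlong (hJ₁ : J₁ 0 0 ≠ 0) (u : finAdelicOne F E c) :
    (finAdelicEquiv F E c N J (finAdelicCenter F E c N J u) :
        Πʳ v : HeightOneSpectrum (𝓞 F), [localPi E c N J v, localInt E c N J v]) =
      RestrictedProduct.mapAlongMonoidHom (fun v => localPi E c 1 J₁ v) (fun v => localPi E c N J v) id Filter.tendsto_id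
        (fun v => localCenter E c N J J₁ hJ₁ v) (Eventually.of_forall fun v => localCenter_mapsTo_localInt E c N J J₁ hJ₁ v)
        (finAdelicEquiv F E c 1 J₁ (finAdelicCenter F E c 1 J₁ u)) :=
  RestrictedProduct.ext _ _ fun v => finAdelicEquiv_finAdelicCenter F E c N J J₁ hJ₁ u v

variable {n : ℕ} (e : Fin N × Fin 1 ≃ Fin n)

omit [NumberField F] in
/-- **For a line `W`, `reindex e e (1_N ⊗ₖ u·1_1) = u·1_n`**: the `U(J_W)`-member of the finite-adelic pair embedding,
composed with the centre `u ↦ u·1_W` of `U(J_W)`, IS the centre of the big group `U(J_{VW})`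
([Liu2021, App. D §D.1 Step 3]: the centre `E¹` of `U(V)` acts through `Mp(V_ε)`). [cite: Mok2014, §1 Notation p. 5] -/
theorem finPairEmb_one_finAdelicCenter (u : finAdelicOne F E c) :
    finPairEmb F E c N 1 e J J₁ (1, finAdelicCenter F E c 1 J₁ u) =
      finAdelicCenter F E c n (Matrix.reindex e e (J ⊗ₖ J₁)) u := by
  refine Subtype.ext (Units.ext (Matrix.ext fun a b => ?_))
  obtain ⟨⟨i, i'⟩, rfl⟩ := e.surjective a
  obtain ⟨⟨j, j'⟩, rfl⟩ := e.surjective b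
  obtain rfl : i' = 0 := Subsingleton.elim _ _
  obtain rfl : j' = 0 := Subsingleton.elim _ _
  rw [coe_finPairEmb, coe_reindexGL, Matrix.reindex_apply, Matrix.submatrix_apply, Equiv.symm_apply_apply,
    Equiv.symm_apply_apply, coe_kroneckerGL, Matrix.kroneckerMap_apply, coe_finAdelicCenter, coe_finAdelicCenter]
  simp only [OneMemClass.coe_one, Units.val_one, Matrix.smul_apply, Matrix.one_apply, EmbeddingLike.apply_eq_iff_eq,
    Prod.mk.injEq, and_true, if_true, smul_eq_mul, mul_one]
  by_cases hij : i = j <;> simp [hij]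

end Global

/-! ## §3 `E¹(𝔸_{F,f}) ≅ U(J₁)(𝔸_{F,f})`: the inverse `g ↦ g₀₀` and continuity -/

section RankOne

omit [NumberField F] in
/-- the determinant (= the entry) of a `1 × 1` finite-adelic unitary matrix is a norm-one idèle. [cite: Mok2014, §1 Notation p. 5] -/
theorem det_mem_finAdelicOne (hJ₁ : J₁ 0 0 ≠ 0) (g : finAdelic F E c 1 J₁) :
    Matrix.GeneralLinearGroup.det (g : GL (Fin 1) (FiniteAdeleRing (𝓞 E) E)) ∈ finAdelicOne F E c := by
  rw [mem_finAdelicOne_iff, Matrix.GeneralLinearGroup.val_det_apply, Matrix.det_fin_one]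
  have hg := (mem_finAdelic_iff F E c 1 J₁ _).1 g.2
  have h00 := congrFun (congrFun hg 0) 0
  simp only [Matrix.mul_apply, Fin.sum_univ_one, Matrix.transpose_apply, Matrix.map_apply] at h00
  have hj : IsUnit (finiteAdelicForm E 1 J₁ 0 0) := by
    change IsUnit (algebraMap E (FiniteAdeleRing (𝓞 E) E) (J₁ 0 0))
    exact (isUnit_iff_ne_zero.2 hJ₁).map _
  refine (hj.mul_left_inj).1 ?_
  rw [one_mul]
  refine Eq.trans ?_ h00
  ring

/-- **`U(J₁)(𝔸_{F,f}) →* E¹(𝔸_{F,f})`, `g ↦ det g = g₀₀`** — the inverse of `finAdelicCenter … 1 J₁`.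
[cite: Mok2014, §1 Notation p. 5] -/
def finAdelicCenterInv (hJ₁ : J₁ 0 0 ≠ 0) : finAdelic F E c 1 J₁ →* finAdelicOne F E c :=
  (Matrix.GeneralLinearGroup.det.comp (finAdelic F E c 1 J₁).subtype).codRestrict _ fun g => det_mem_finAdelicOne F E c J₁ hJ₁ g

omit [NumberField F] in
/-- underlying unit of `finAdelicCenterInv g`: `det g`. [cite: Mok2014, §1 Notation p. 5] -/
@[simp] theorem coe_finAdelicCenterInv (hJ₁ : J₁ 0 0 ≠ 0) (g : finAdelic F E c 1 J₁) :
    ((finAdelicCenterInv F E c J₁ hJ₁ g : finAdelicOne F E c) : (FiniteAdeleRing (𝓞 E) E)ˣ) =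
      Matrix.GeneralLinearGroup.det (g : GL (Fin 1) (FiniteAdeleRing (𝓞 E) E)) := rfl

omit [NumberField F] in
/-- `det (u·1_1) = u`. [cite: Mok2014, §1 Notation p. 5] -/
theorem finAdelicCenterInv_finAdelicCenter (hJ₁ : J₁ 0 0 ≠ 0) (u : finAdelicOne F E c) :
    finAdelicCenterInv F E c J₁ hJ₁ (finAdelicCenter F E c 1 J₁ u) = u := by
  refine Subtype.ext (Units.ext ?_)
  rw [coe_finAdelicCenterInv, Matrix.GeneralLinearGroup.val_det_apply, coe_finAdelicCenter, Matrix.det_fin_one,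
    Matrix.smul_apply, Matrix.one_apply_eq, smul_eq_mul, mul_one]

omit [NumberField F] in
/-- `(det g)·1_1 = g` for `1 × 1` matrices. [cite: Mok2014, §1 Notation p. 5] -/
theorem finAdelicCenter_finAdelicCenterInv (hJ₁ : J₁ 0 0 ≠ 0) (g : finAdelic F E c 1 J₁) :
    finAdelicCenter F E c 1 J₁ (finAdelicCenterInv F E c J₁ hJ₁ g) = g := by
  refine Subtype.ext (Units.ext (Matrix.ext fun i j => ?_))
  obtain rfl : i = 0 := Subsingleton.elim _ _
  obtain rfl : j = 0 := Subsingleton.elim _ _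
  rw [coe_finAdelicCenter, Matrix.smul_apply, Matrix.one_apply_eq, smul_eq_mul, mul_one, coe_finAdelicCenterInv,
    Matrix.GeneralLinearGroup.val_det_apply, Matrix.det_fin_one]

omit [NumberField F] in
/-- `finAdelicCenterInv` is continuous (a determinant). [cite: Mok2014, §1 Notation p. 5] -/
theorem continuous_finAdelicCenterInv (hJ₁ : J₁ 0 0 ≠ 0) : Continuous (finAdelicCenterInv F E c J₁ hJ₁) := by
  have hdet : Continuous
      (Matrix.GeneralLinearGroup.det : GL (Fin 1) (FiniteAdeleRing (𝓞 E) E) → (FiniteAdeleRing (𝓞 E) E)ˣ) := by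
    refine Units.continuous_iff.2 ⟨?_, ?_⟩
    · exact (Units.continuous_val.matrix_det).congr fun g => (Matrix.GeneralLinearGroup.val_det_apply g).symm
    · refine (Units.continuous_coe_inv.matrix_det).congr fun g => ?_
      rw [← map_inv, Matrix.GeneralLinearGroup.val_det_apply]
  exact Continuous.subtype_mk (hdet.comp continuous_subtype_val) _

omit [NumberField F] in
/-- `finAdelicCenter` is continuous (`u ↦ u·1_N`). [cite: Mok2014, §1 Notation p. 5] -/
theorem continuous_finAdelicCenter : Continuous (finAdelicCenter F E c N J) := by
  have hsc : Continuous fun r : FiniteAdeleRing (𝓞 E) E => Matrix.scalar (Fin N) r := by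
    simp only [Matrix.scalar_apply]
    exact (continuous_pi fun _ => continuous_id).matrix_diagonal
  exact Continuous.subtype_mk ((Continuous.units_map _ hsc).comp continuous_subtype_val) _

/-- **`E¹(𝔸_{F,f}) → Πʳ_v [U(J₁)(F_v), U(J₁)(𝒪_v)]` is onto** (`finAdelicCenter … 1 J₁` onto for a line, `finAdelicEquiv` an
isomorphism). [cite: PlatonovRapinchuk1994, §5.1] -/
theorem finAdelicEquiv_comp_finAdelicCenter_surjective (hJ₁ : J₁ 0 0 ≠ 0) :
    Function.Surjective ((finAdelicEquiv F E c 1 J₁).toMonoidHom.comp (finAdelicCenter F E c 1 J₁)) :=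
  (finAdelicEquiv F E c 1 J₁).surjective.comp (finAdelicCenter_surjective_one F E c J₁ hJ₁)

/-- **a character of `E¹(𝔸_{F,f})` read on `Πʳ_v [U(J₁)(F_v), U(J₁)(𝒪_v)]`**: `χ₁ ∘ det ∘ finAdelicEquiv⁻¹`; it restricts
back to `χ₁` (`charOfCenter_comp`) and is continuous when `χ₁` is (`continuous_charOfCenter`). [cite: Mok2014, §1 Notation p. 5] -/
def charOfCenter (hJ₁ : J₁ 0 0 ≠ 0) (χ₁ : finAdelicOne F E c →* ℂˣ) :
    (Πʳ v : HeightOneSpectrum (𝓞 F), [localPi E c 1 J₁ v, localInt E c 1 J₁ v]) →* ℂˣ :=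
  χ₁.comp ((finAdelicCenterInv F E c J₁ hJ₁).comp (finAdelicEquiv F E c 1 J₁).symm.toMonoidHom)

/-- `charOfCenter χ₁ ∘ (finAdelicEquiv ∘ finAdelicCenter) = χ₁`. [cite: Mok2014, §1 Notation p. 5] -/
theorem charOfCenter_comp (hJ₁ : J₁ 0 0 ≠ 0) (χ₁ : finAdelicOne F E c →* ℂˣ) :
    (charOfCenter F E c J₁ hJ₁ χ₁).comp ((finAdelicEquiv F E c 1 J₁).toMonoidHom.comp (finAdelicCenter F E c 1 J₁)) = χ₁ := by
  refine MonoidHom.ext fun u => ?_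
  change χ₁ (finAdelicCenterInv F E c J₁ hJ₁ ((finAdelicEquiv F E c 1 J₁).symm
    (finAdelicEquiv F E c 1 J₁ (finAdelicCenter F E c 1 J₁ u)))) = χ₁ u
  rw [ContinuousMulEquiv.symm_apply_apply, finAdelicCenterInv_finAdelicCenter]

/-- `charOfCenter χ₁` is continuous for `χ₁` continuous. [cite: Mok2014, §1 Notation p. 5] -/
theorem continuous_charOfCenter (hJ₁ : J₁ 0 0 ≠ 0) {χ₁ : finAdelicOne F E c →* ℂˣ} (hχ₁ : Continuous χ₁) :
    Continuous (charOfCenter F E c J₁ hJ₁ χ₁) :=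
  hχ₁.comp ((continuous_finAdelicCenterInv F E c J₁ hJ₁).comp (finAdelicEquiv F E c 1 J₁).symm.continuous)

end RankOne

end Literature.NumberTheory.Automorphic.UnitaryGroup

end
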